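import Literature.Topology.FourManifolds.FibrewiseMorseParam
import Literature.Topology.FourManifolds.IntrinsicFoldCriterion
import Literature.Analysis.Calculus.HadamardDivisionLast
import HarnessLib

/-!
# Splitting two Morse variables off a critical point of a rank-one map `ℝ⁴ → ℝ²`

Topic `Literature/Topology/FourManifolds` (programme of the fact
`Literature.Topology.FourManifolds.exists_isSimplifiedBrokenLefschetzFibration`, Baykur–Saeki 2017, §2.1:
generic maps `X⁴ → Σ²` have folds and cusps, the cusp being modelled on
`(t, x, y, z) ↦ (t, x³ + tx ± y² ± z²)`).  At a cusp candidate of a map in rank-one form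
`y ↦ (y₀, f y)` (`RankOneMapJets.lean`) the fibre Hessian of `f` has rank two; splitting off the
two nondegenerate fibre variables is the parametric Morse lemma over the PLANE of parameters
`(t, x) = (y₀, y₁)` (Golubitsky–Guillemin VI §2, reduction to the coordinates `(†)`; Hirsch,
*Differential Topology*, Ch. 6 §1 with parameters).  The analysis over a general parameter space
is in `FibrewiseMorseParam.lean`; this file supplies the plumbing for `P = ℝ × ℝ`, `k = 2`:

* `split4 : ℝ⁴ ≃L (ℝ × ℝ) × ℝ²`, `y ↦ ((y₀, y₁), (y₂, y₃))`;
* `Splitting.fibreHessian_eq_of_eq_translate`, `Splitting.exists_cutoffFamily` — the general-`P`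
  versions of the corresponding lemmas of `GenericFoldChart.lean`;
* **`exists_cuspSplittingCoords`** — for `f : ℝ⁴ → ℝ` `C^∞` with `df_{y₀}` vanishing on the fibre
  `{v | v₀ = 0}` and the `(y₂, y₃)`-block of `D²f_{y₀}` nondegenerate: a `C^∞` critical section
  `ξ(t, x)` and `C^∞` fibre coordinates `η((t, x), u)` (`η(p, 0) = 0`, `∂ᵤη(p₀, 0)` invertible)
  with `f(t, x, ξ(t,x) + u) = f(t, x, ξ(t,x)) - Σ_{i<σ} ηᵢ² + Σ_{i≥σ} ηᵢ²`.

Everything is proved; `split4`, `split4L`, `unsplit4L` are the only definitions; no named fact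
(D-0026).

## References

* M. W. Hirsch, *Differential Topology*, GTM 33 (1976), Ch. 6 §1 (Morse lemma; with parameters).
  [HirschDT1976]
* M. Golubitsky, V. Guillemin, *Stable Mappings and Their Singularities*, GTM 14 (1973), Ch. VI
  §2, proof of Thm. 2.4 (coordinates `(†)`). [GolubitskyGuillemin1973]
* R. İ. Baykur, O. Saeki, *Simplifying indefinite fibrations on 4-manifolds*, arXiv:1705.11169,
  §2.1, p. 6. [BaykurSaeki2017]
-/

noncomputable section

open Set Function Filter Module
open scoped ContDiff Topology

namespace Literature.Topology.FourManifolds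

/-! ### General-parameter plumbing -/

namespace Splitting

/-- Local notation: `𝔼 n` is the model Euclidean space `EuclideanSpace ℝ (Fin n)`. -/
local notation "𝔼 " n:arg => EuclideanSpace ℝ (Fin n)

variable {P : Type*} [NormedAddCommGroup P] [NormedSpace ℝ P] {k : ℕ}

/-- **Second fibre derivatives are translation invariant** (general parameter space): if
`g (p₀, u) = f (p₀, w₀ + u) - C` for all `u` then `fibreHessian g (p₀, 0) = fibreHessian f (p₀, w₀)`.
[folklore] -/
theorem fibreHessian_eq_of_eq_translate {g f : P × 𝔼 k → ℝ} (hg : ContDiff ℝ ∞ g)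
    (hf : ContDiff ℝ ∞ f) {p₀ : P} {w₀ : 𝔼 k} {C : ℝ}
    (h : ∀ u, g (p₀, u) = f (p₀, w₀ + u) - C) :
    fibreHessian g (p₀, 0) = fibreHessian f (p₀, w₀) := by
  have h2 : (2 : WithTop ℕ∞) ≤ ∞ := WithTop.coe_le_coe.2 le_top
  ext a b
  rw [fibreHessian_apply, fibreHessian_apply,
    ← Literature.Analysis.Calculus.fderiv_fderiv_partial_snd hg h2,
    ← Literature.Analysis.Calculus.fderiv_fderiv_partial_snd hf h2]
  set F₁ : 𝔼 k → ℝ := fun w => f (p₀, w) with hF₁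
  have hF₁s : ContDiff ℝ ∞ F₁ := Literature.Analysis.Calculus.contDiff_partial_snd hf p₀
  have hF₁d : ∀ w, HasFDerivAt F₁ (fderiv ℝ F₁ w) w := fun w =>
    ((hF₁s.differentiable (by simp)) w).hasFDerivAt
  set F₂ : 𝔼 k → (𝔼 k →L[ℝ] ℝ) := fderiv ℝ F₁ with hF₂
  have hF₂d : ∀ w, HasFDerivAt F₂ (fderiv ℝ F₂ w) w := fun w =>
    (((hF₁s.fderiv_right (m := ∞) le_rfl).differentiable (by simp)) w).hasFDerivAt
  have hfun : (fun u => g (p₀, u)) = fun u => F₁ (w₀ + u) - C := funext h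
  have hd1 : fderiv ℝ (fun u => F₁ (w₀ + u) - C) = fun u => F₂ (w₀ + u) := by
    funext u
    have h1 : HasFDerivAt (fun u => F₁ (w₀ + u) - C) (fderiv ℝ F₁ (w₀ + u)) u :=
      (((hF₁d (w₀ + u)).comp u ((hasFDerivAt_id u).const_add w₀)).sub_const C).congr_fderiv
        (by simp [hF₂])
    exact h1.fderiv
  have hd2 : HasFDerivAt (fun u => F₂ (w₀ + u)) (fderiv ℝ F₂ (w₀ + 0)) 0 :=
    ((hF₂d (w₀ + 0)).comp (0 : 𝔼 k) ((hasFDerivAt_id (0 : 𝔼 k)).const_add w₀)).congr_fderiv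
      (by simp)
  rw [hfun, hd1, hd2.fderiv, add_zero]

variable [FiniteDimensional ℝ P]

/-- **The cut-off family** (general parameter space): given the critical section `ξ` of `f` on
the open `U ∋ p₀` (`∂_w f (p, ξ p) = 0`), the family `g (p, u) = ρ(p) (f (p, ξ p + u) - f (p, ξ p))`
with a smooth bump `ρ` supported in `U` and `≡ 1` near `p₀` is globally `C^∞`, has the zero
section critical for ALL `p`, and equals `f (p, ξ p + u) - f (p, ξ p)` for `p` in an open
`V ∋ p₀`. [folklore] -/
theorem exists_cutoffFamily {f : P × 𝔼 k → ℝ} (hf : ContDiff ℝ ∞ f) {U : Set P} (hU : IsOpen U)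
    {p₀ : P} (hp₀ : p₀ ∈ U) {ξ : P → 𝔼 k} (hξ : ContDiffOn ℝ ∞ ξ U)
    (hcrit : ∀ p ∈ U, ∀ a : 𝔼 k, fderiv ℝ f (p, ξ p) ((0 : P), a) = 0) :
    ∃ (V : Set P) (g : P × 𝔼 k → ℝ), IsOpen V ∧ p₀ ∈ V ∧ V ⊆ U ∧ ContDiff ℝ ∞ g ∧
      (∀ p, g (p, 0) = 0) ∧ (∀ (p : P) (a : 𝔼 k), fderiv ℝ g (p, 0) ((0 : P), a) = 0) ∧
      ∀ p ∈ V, ∀ u, g (p, u) = f (p, ξ p + u) - f (p, ξ p) := by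
  obtain ⟨ρ, hρ, hρU, hρ1⟩ := Literature.Analysis.Calculus.exists_contDiff_bump_nhds hU hp₀
  obtain ⟨V, hVsub, hVo, hp₀V⟩ : ∃ V ⊆ U ∩ {p | ρ p = 1}, IsOpen V ∧ p₀ ∈ V :=
    _root_.mem_nhds_iff.1 (Filter.inter_mem (hU.mem_nhds hp₀) hρ1)
  set g : P × 𝔼 k → ℝ := fun q => ρ q.1 * (f (q.1, ξ q.1 + q.2) - f (q.1, ξ q.1)) with hg_def
  have hgs : ContDiff ℝ ∞ g := by
    rw [contDiff_iff_contDiffAt]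
    intro q
    by_cases hq : q.1 ∈ U
    · have hξq : ContDiffAt ℝ ∞ (fun q : P × 𝔼 k => ξ q.1) q :=
        (hξ.contDiffAt (hU.mem_nhds hq)).comp q contDiffAt_fst
      exact ((hρ.comp contDiff_fst).contDiffAt).mul
        ((hf.contDiffAt.comp q (contDiffAt_fst.prodMk (hξq.add contDiffAt_snd))).sub
          (hf.contDiffAt.comp q (contDiffAt_fst.prodMk hξq)))
    · have hq' : q.1 ∉ tsupport ρ := fun h => hq (hρU h)
      have hev : g =ᶠ[𝓝 q] fun _ => 0 := by
        have ho : IsOpen ((tsupport ρ)ᶜ ×ˢ (univ : Set (𝔼 k))) :=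
          (isClosed_tsupport ρ).isOpen_compl.prod isOpen_univ
        filter_upwards [ho.mem_nhds ⟨hq', mem_univ _⟩] with r hr
        show ρ r.1 * _ = 0
        rw [image_eq_zero_of_notMem_tsupport hr.1, zero_mul]
      exact (contDiffAt_const (c := (0 : ℝ))).congr_of_eventuallyEq hev
  refine ⟨V, g, hVo, hp₀V, fun p hp => (hVsub hp).1, hgs, fun p => by simp [hg_def], ?_, ?_⟩
  · intro p a
    have hgd : DifferentiableAt ℝ g (p, 0) := (hgs.differentiable (by simp)) _
    rw [show (((0 : P), a) : P × 𝔼 k) = ContinuousLinearMap.inr ℝ P (𝔼 k) a by simp,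
      ← ContinuousLinearMap.comp_apply,
      ← Literature.Analysis.Calculus.fderiv_partial_snd hgd]
    have hline : HasFDerivAt (fun u : 𝔼 k => ((p, ξ p + u) : P × 𝔼 k))
        (ContinuousLinearMap.inr ℝ P (𝔼 k)) 0 := by
      refine ((hasFDerivAt_const p (0 : 𝔼 k)).prodMk
        ((hasFDerivAt_id (0 : 𝔼 k)).const_add (ξ p))).congr_fderiv ?_
      refine ContinuousLinearMap.ext fun v => Prod.ext ?_ ?_ <;> simp
    have hF : HasFDerivAt (fun u : 𝔼 k => f (p, ξ p + u))
        ((fderiv ℝ f (p, ξ p + 0)).comp (ContinuousLinearMap.inr ℝ P (𝔼 k))) 0 :=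
      ((hf.differentiable (by simp)) _).hasFDerivAt.comp (0 : 𝔼 k) hline
    have hG : HasFDerivAt (fun u : 𝔼 k => g (p, u))
        (ρ p • ((fderiv ℝ f (p, ξ p + 0)).comp (ContinuousLinearMap.inr ℝ P (𝔼 k)))) 0 :=
      (hF.sub_const (f (p, ξ p))).const_mul (ρ p)
    rw [hG.fderiv]
    show ρ p * fderiv ℝ f (p, ξ p + 0) (ContinuousLinearMap.inr ℝ P (𝔼 k) a) = 0
    rw [add_zero, ContinuousLinearMap.inr_apply]
    by_cases hp : p ∈ U
    · rw [hcrit p hp a, mul_zero]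
    · rw [image_eq_zero_of_notMem_tsupport (fun h => hp (hρU h)), zero_mul]
  · intro p hp u
    have hρp : ρ p = 1 := (hVsub hp).2
    simp [hg_def, hρp]

end Splitting

/-! ### The splitting `ℝ⁴ ≃ (ℝ × ℝ) × ℝ²` -/

section Split

/-- Local notation: `𝔼 n` is the model Euclidean space `EuclideanSpace ℝ (Fin n)`. -/
local notation "𝔼 " n:arg => EuclideanSpace ℝ (Fin n)

/-- Local notation: the coordinate covectors of `ℝ⁴`. -/
local notation "π₄" => (EuclideanSpace.proj (𝕜 := ℝ) (ι := Fin 4))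

/-- `y ↦ ((y₀, y₁), (y₂, y₃))`. [folklore] -/
def split4L : 𝔼 4 →L[ℝ] (ℝ × ℝ) × 𝔼 2 :=
  ((π₄ 0).prod (π₄ 1)).prod
    ((π₄ 2).smulRight (EuclideanSpace.single (0 : Fin 2) (1 : ℝ)) +
      (π₄ 3).smulRight (EuclideanSpace.single (1 : Fin 2) (1 : ℝ)))

/-- `((t, x), u) ↦ (t, x, u₀, u₁)`. [folklore] -/
def unsplit4L : ((ℝ × ℝ) × 𝔼 2) →L[ℝ] 𝔼 4 :=
  ((ContinuousLinearMap.fst ℝ ℝ ℝ).comp (ContinuousLinearMap.fst ℝ (ℝ × ℝ) (𝔼 2))).smulRight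
      (EuclideanSpace.single (0 : Fin 4) (1 : ℝ)) +
    ((ContinuousLinearMap.snd ℝ ℝ ℝ).comp (ContinuousLinearMap.fst ℝ (ℝ × ℝ) (𝔼 2))).smulRight
      (EuclideanSpace.single (1 : Fin 4) (1 : ℝ)) +
    ((EuclideanSpace.proj (0 : Fin 2) : 𝔼 2 →L[ℝ] ℝ).comp
        (ContinuousLinearMap.snd ℝ (ℝ × ℝ) (𝔼 2))).smulRight
      (EuclideanSpace.single (2 : Fin 4) (1 : ℝ)) +
    ((EuclideanSpace.proj (1 : Fin 2) : 𝔼 2 →L[ℝ] ℝ).comp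
        (ContinuousLinearMap.snd ℝ (ℝ × ℝ) (𝔼 2))).smulRight
      (EuclideanSpace.single (3 : Fin 4) (1 : ℝ))

/-- `split4L y = ((y₀, y₁), (y₂, y₃))`. [folklore] -/
theorem split4L_apply (y : 𝔼 4) :
    split4L y = ((y 0, y 1), WithLp.toLp 2 ![y 2, y 3]) := by
  refine Prod.ext (Prod.ext rfl rfl) ?_
  ext i
  fin_cases i <;> simp [split4L]

/-- `unsplit4L ((t, x), u) = (t, x, u₀, u₁)`. [folklore] -/
theorem unsplit4L_apply (q : (ℝ × ℝ) × 𝔼 2) :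
    unsplit4L q = WithLp.toLp 2 ![q.1.1, q.1.2, q.2 0, q.2 1] := by
  ext i
  fin_cases i <;> simp [unsplit4L]

/-- **The splitting `ℝ⁴ ≃ (ℝ × ℝ) × ℝ²`**, `y ↦ ((y₀, y₁), (y₂, y₃))`. [folklore] -/
def split4 : 𝔼 4 ≃L[ℝ] (ℝ × ℝ) × 𝔼 2 :=
  ContinuousLinearEquiv.equivOfInverse split4L unsplit4L
    (fun y => by
      rw [unsplit4L_apply, split4L_apply]
      ext i
      fin_cases i <;> simp)
    (fun q => by
      rw [split4L_apply, unsplit4L_apply]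
      refine Prod.ext (Prod.ext (by simp) (by simp)) ?_
      ext i
      fin_cases i <;> simp)

/-- `split4 y = ((y₀, y₁), (y₂, y₃))`. [folklore] -/
theorem split4_apply (y : 𝔼 4) : split4 y = ((y 0, y 1), WithLp.toLp 2 ![y 2, y 3]) :=
  split4L_apply y

/-- `split4⁻¹ ((t, x), u) = (t, x, u₀, u₁)`. [folklore] -/
theorem split4_symm_apply (q : (ℝ × ℝ) × 𝔼 2) :
    split4.symm q = WithLp.toLp 2 ![q.1.1, q.1.2, q.2 0, q.2 1] :=
  unsplit4L_apply q

/-- Fibre vectors of the splitting lie in the fibre `{v | v₀ = 0}` of `ℝ⁴`. [folklore] -/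
@[simp]
theorem split4_symm_inr_apply_zero (a : 𝔼 2) : split4.symm (((0 : ℝ), (0 : ℝ)), a) 0 = 0 := by
  rw [split4_symm_apply]
  simp

/-! ### The splitting at a critical point with nondegenerate `(y₂, y₃)`-Hessian -/

/-- `2 ≤ ∞` in `WithTop ℕ∞`. [folklore] -/
private theorem two_le_infty₃ : (2 : WithTop ℕ∞) ≤ ∞ := WithTop.coe_le_coe.2 le_top

/-- **Splitting two Morse variables off a critical point of a rank-one map.**  Let
`f : ℝ⁴ → ℝ` be `C^∞`, `y₀` a point where `df_{y₀}` vanishes on the fibre `{v | v₀ = 0}`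
(`y₀` is a critical point of `y ↦ (y₀, f y)`) and where the `(y₂, y₃)`-block of `D²f_{y₀}` is
nondegenerate.  Then over an open neighbourhood `V` of `p₀ = (y₀₀, y₀₁)` in the parameter plane
there are a `C^∞` critical section `ξ : V → ℝ²` through `(y₀₂, y₀₃)`, and on an open
`W ∋ (p₀, 0)` `C^∞` fibre coordinates `η` (`η(p, 0) = 0`, `∂ᵤ η(p₀, 0) = Λ` invertible) and an
index `σ` with
`f(t, x, ξ(t,x) + u) = f(t, x, ξ(t,x)) - Σ_{i<σ} ηᵢ((t,x),u)² + Σ_{i≥σ} ηᵢ((t,x),u)²`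
for `((t, x), u) ∈ W` — the parametric Morse lemma over the plane (Hirsch Ch. 6 §1), the
reduction to Golubitsky–Guillemin's coordinates `(†)` one dimension up.
[cite: HirschDT1976, Ch. 6 §1] [cite: GolubitskyGuillemin1973, Ch. VI §2, proof of Thm. 2.4] -/
theorem exists_cuspSplittingCoords {f : 𝔼 4 → ℝ} (hf : ContDiff ℝ ∞ f) {y₀ : 𝔼 4}
    (hcrit : ∀ v : 𝔼 4, v 0 = 0 → fderiv ℝ f y₀ v = 0)
    (hnd : ∀ a : 𝔼 2, (∀ b : 𝔼 2, fderiv ℝ (fderiv ℝ f) y₀ (split4.symm (((0 : ℝ), (0 : ℝ)), a))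
      (split4.symm (((0 : ℝ), (0 : ℝ)), b)) = 0) → a = 0) :
    ∃ (V : Set (ℝ × ℝ)) (ξ : ℝ × ℝ → 𝔼 2) (W : Set ((ℝ × ℝ) × 𝔼 2))
      (η : (ℝ × ℝ) × 𝔼 2 → 𝔼 2) (Λ : 𝔼 2 ≃L[ℝ] 𝔼 2) (σ : ℕ),
      IsOpen V ∧ (y₀ 0, y₀ 1) ∈ V ∧ ContDiffOn ℝ ∞ ξ V ∧ ξ (y₀ 0, y₀ 1) = (split4 y₀).2 ∧
      (∀ p ∈ V, ∀ a : 𝔼 2, fderiv ℝ f (split4.symm (p, ξ p)) (split4.symm (((0 : ℝ), (0 : ℝ)), a)) = 0) ∧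
      IsOpen W ∧ (((y₀ 0, y₀ 1), (0 : 𝔼 2)) : (ℝ × ℝ) × 𝔼 2) ∈ W ∧ (∀ q ∈ W, q.1 ∈ V) ∧
      ContDiffOn ℝ ∞ η W ∧ (∀ p : ℝ × ℝ, ((p, (0 : 𝔼 2)) : (ℝ × ℝ) × 𝔼 2) ∈ W → η (p, 0) = 0) ∧
      HasFDerivAt (fun u : 𝔼 2 => η ((y₀ 0, y₀ 1), u)) (Λ : 𝔼 2 →L[ℝ] 𝔼 2) 0 ∧
      ∀ q ∈ W, f (split4.symm (q.1, ξ q.1 + q.2)) =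
        f (split4.symm (q.1, ξ q.1)) -
          ∑ i ∈ Finset.univ.filter (fun i : Fin 2 => i.val < σ), (η q i) ^ 2 +
          ∑ i ∈ Finset.univ.filter (fun i : Fin 2 => σ ≤ i.val), (η q i) ^ 2 := by
  -- the family over the parameter plane
  set f₂ : (ℝ × ℝ) × 𝔼 2 → ℝ := f ∘ split4.symm with hf₂_def
  have hf₂ : ContDiff ℝ ∞ f₂ := hf.comp split4.symm.contDiff
  set p₀ : ℝ × ℝ := (y₀ 0, y₀ 1) with hp₀
  set w₀ : 𝔼 2 := (split4 y₀).2 with hw₀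
  have hy₀ : split4.symm (p₀, w₀) = y₀ := by
    have : (p₀, w₀) = split4 y₀ := by
      rw [hp₀, hw₀, split4_apply]
    rw [this, ContinuousLinearEquiv.symm_apply_apply]
  -- first and second derivatives of `f₂` through the linear splitting
  have hd1 : ∀ q v, fderiv ℝ f₂ q v = fderiv ℝ f (split4.symm q) (split4.symm v) := by
    intro q v
    rw [hf₂_def, split4.symm.comp_right_fderiv]
    rfl
  have hd2 : ∀ q v w, fderiv ℝ (fderiv ℝ f₂) q v w =
      fderiv ℝ (fderiv ℝ f) (split4.symm q) (split4.symm v) (split4.symm w) := by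
    intro q v w
    have hτ2 : ContDiffAt ℝ 2 (split4.symm : (ℝ × ℝ) × 𝔼 2 → 𝔼 4) q :=
      split4.symm.contDiff.contDiffAt.of_le two_le_infty₃
    have hF2 : ContDiffAt ℝ 2 f (split4.symm q) := hf.contDiffAt.of_le two_le_infty₃
    rw [hf₂_def, fderiv_fderiv_comp_apply_eq_add hF2 hτ2 v w]
    have h0 : fderiv ℝ (fderiv ℝ (split4.symm : (ℝ × ℝ) × 𝔼 2 → 𝔼 4)) q v w = 0 := by
      have : fderiv ℝ (split4.symm : (ℝ × ℝ) × 𝔼 2 → 𝔼 4) =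
          fun _ => (split4.symm : ((ℝ × ℝ) × 𝔼 2) →L[ℝ] 𝔼 4) := by
        funext q'
        exact split4.symm.fderiv
      rw [this]
      simp
    rw [h0, map_zero, zero_add, split4.symm.fderiv]
    rfl
  -- Step 1: the critical section
  have hcrit₂ : Splitting.fibreGrad f₂ (p₀, w₀) = 0 := by
    rw [Splitting.fibreGrad_eq_zero_iff]
    intro a
    rw [hd1, hy₀]
    exact hcrit _ (split4_symm_inr_apply_zero a)
  have hH₂ : ∀ a : 𝔼 2, (∀ b : 𝔼 2,
      fderiv ℝ (fderiv ℝ f₂) (p₀, w₀) (((0 : ℝ), (0 : ℝ)), a) (((0 : ℝ), (0 : ℝ)), b) = 0) →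
        a = 0 := by
    intro a ha
    refine hnd a fun b => ?_
    rw [← hy₀, ← hd2]
    exact ha b
  obtain ⟨U, hUo, hp₀U, ξ, hξ, hξ₀, hξcrit⟩ :=
    Splitting.exists_fibrewiseCriticalSection hf₂ hcrit₂ hH₂
  have hξcrit' : ∀ p ∈ U, ∀ a : 𝔼 2, fderiv ℝ f₂ (p, ξ p) (((0 : ℝ), (0 : ℝ)), a) = 0 :=
    fun p hp => (Splitting.fibreGrad_eq_zero_iff f₂ _).1 (hξcrit p hp)
  -- Step 2: the cut-off family
  obtain ⟨V, g, hVo, hp₀V, hVU, hg, hg0, hg1, hgV⟩ :=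
    Splitting.exists_cutoffFamily hf₂ hUo hp₀U hξ hξcrit'
  have hgp₀ : ∀ u, g (p₀, u) = f₂ (p₀, w₀ + u) - f₂ (p₀, w₀) := fun u => by
    rw [hgV p₀ hp₀V u, hξ₀]
  have hHg : Splitting.fibreHessian g (p₀, 0) = Splitting.fibreHessian f₂ (p₀, w₀) :=
    Splitting.fibreHessian_eq_of_eq_translate hg hf₂ hgp₀
  have hHgnd : ∀ a : 𝔼 2, (∀ b, Splitting.fibreHessian g (p₀, 0) a b = 0) → a = 0 := by
    intro a ha
    rw [hHg] at ha
    refine hH₂ a fun b => ?_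
    have h := ha b
    rw [Splitting.fibreHessian_apply] at h
    exact h
  -- Step 3: fibrewise Morse coordinates
  obtain ⟨W, η, Λ, hWo, hW₀, hηs, hη0, hηd, hgη⟩ :=
    Splitting.exists_fibrewiseMorseCoords hg hg0 hg1 hHgnd
  set σ : ℕ := sigNeg ((Splitting.fibreHessian g (p₀, 0)).toBilinForm).toQuadraticMap with hσ
  -- the neighbourhood on which everything holds
  set W' : Set ((ℝ × ℝ) × 𝔼 2) := W ∩ Prod.fst ⁻¹' V with hW'
  have hW'o : IsOpen W' := hWo.inter (hVo.preimage continuous_fst)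
  refine ⟨V, ξ, W', η, Λ, σ, hVo, hp₀V, hξ.mono hVU, hξ₀, ?_, hW'o, ⟨hW₀, hp₀V⟩,
    fun q hq => hq.2, hηs.mono inter_subset_left, fun p hp => hη0 p hp.1, hηd, ?_⟩
  · intro p hp a
    have h := hξcrit' p (hVU hp) a
    rwa [hd1] at h
  · intro q hq
    have h1 := hgη q hq.1
    have h2 := hgV q.1 hq.2 q.2
    have h3 : f₂ (q.1, ξ q.1 + q.2) = f₂ (q.1, ξ q.1) + g q := by
      rw [show q = (q.1, q.2) from rfl, h2]
      ring
    show f₂ (q.1, ξ q.1 + q.2) = f₂ (q.1, ξ q.1) - _ + _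
    rw [h3, h1]
    ring

end Split

end Literature.Topology.FourManifolds
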